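import Summits.BirchSwinnertonDyer.BirchSwinnertonDyer.Theorems.CountingDoorF2AtThreeSelmerAverageSieve
import HarnessLib

/-!
# BirchSwinnertonDyer / CountingDoorF2AtThree — support lemmas for crux I2
# `RootNumberPlusLowerDensityLargeF2` (stmt-BirchSwinnertonDyer-19441): the large-family sieve
# reduction for LOWER densities (a lower density on a large subfamily from its finitely-conditioned
# truncations)

Route `route-BirchSwinnertonDyer-CountingDoorF2AtThree` (cell bsd-rank2; TWIN leaf
`PAdicBSDRankTwoPositiveProportion`). Crux I2 asks, for every LARGE `Φ ⊆ F₂` with nonempty local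
conditions, a lower density `ρ > 1/6` of the members with root number `+1`
(`Φ.DensityOnGE (fun a ↦ w(E_a) = 1) ρ`). Any mechanism in sight (root-number equidistribution in
boxes, a sign-reversing correspondence, a sieve-defined sub-locus) is proved first for families with
FINITELY many congruence conditions; this file is the companion of
`Theorems/CountingDoorF2AtThreeSelmerAverageSieve.lean` (I1, averages) for LOWER DENSITIES: the count
of good members only SHRINKS when passing from the truncation `Φ_{<Y}` to `Φ`, but by at most
`#(Φ_{<Y}(<X) ∖ Φ(<X))`, which the `p² ∣ Δ` tail estimate and the positive density of `Φ` make an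
arbitrarily small multiple of `#Φ(<X)`:

* `card_filter_le_of_subfamily`, `densityOnGE_of_forall_subfamily`: `Φ ⊆ Ψ`, `Ψ.DensityOnGE P ρ` and
  eventually `#Ψ(<X) ≤ (1 + δ)·#Φ(<X)` give `prop_Φ(P) ≥ ρ − ε − δ` eventually; if such `Ψ_δ` exist
  for every `δ > 0` then `Φ.DensityOnGE P ρ`;
* `densityOnGE_of_isLarge_of_truncations`: for a LARGE `Φ` of positive lower relative density,
  `Φ.DensityOnGE P ρ` follows from `Φ_{<Y}.DensityOnGE P ρ` for all large `Y` plus the tail estimate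
  (reusing `card_below_le_of_tail` of the I1 sieve file);
* `rootNumberPlusLowerDensity_of_truncations`, `rootNumberPlusLowerDensityLargeF2_of_finiteConditions`:
  the instances for `P = (w = +1)`; the second concludes the route decl
  `RootNumberPlusLowerDensityLargeF2` BY NAME from (i) a UNIFORM lower density `ρ₀ > 1/6` of `w = +1`
  on every family with finitely many congruence conditions and nonempty local conditions
  (equidistribution would give `1/2`), (ii) the tail estimate, (iii) Bhargava–Ho Thm. 9.1 (`thm9_1_F2`,
  via `thm9_1_F2.relative`); and `rootNumberPlusLowerDensity_finiteConditions_of_largeF2` records the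
  converse direction (finitely-conditioned families are large).

Nothing is asserted: (i)–(iii) are explicit hypotheses. PARTITION: none — r_an ≥ 2, summit axis S0;
TWIN (D-0056): n/a. B1 honesty: counting bookkeeping toward an open crux; the root number enters only
as a predicate on members; no analytic rank, no `L`-value; no S0 motion.

References: M. Bhargava, A. Shankar, Ann. of Math. 181 (2015) §2.7 [BhargavaShankarAnnals2015];
M. Bhargava, W. Ho, arXiv:2207.03309 §9.1 (Thm. 9.1, Prop. 9.2) [BhargavaHo2022]; H. Helfgott,
arXiv:math/0408141 (root numbers in families, conditional equidistribution) [Helfgott2004RootNumber].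
-/

set_option linter.dupNamespace false

noncomputable section

open scoped Classical
open Filter Topology Finset
open Literature.NumberTheory.EllipticCurves.BhargavaHo2022
  Summit.BirchSwinnertonDyer.Rank2
  Summit.BirchSwinnertonDyer.BirchSwinnertonDyer.Theses.CountingDoorF2AtThree

namespace Summit.BirchSwinnertonDyer.BirchSwinnertonDyer.Theorems

/-! ### §1 Lower densities along a subfamily -/

/-- If `Φ ⊆ Ψ`, the `P`-members of `Ψ(<X)` outnumber those of `Φ(<X)` by at most
`#Ψ(<X) − #Φ(<X)`: `#{Ψ(<X) | P} ≤ #{Φ(<X) | P} + (#Ψ(<X) − #Φ(<X))`. [folklore] -/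
theorem card_filter_le_of_subfamily {Φ Ψ : CongruenceFamily₂} (hsub : ∀ a, Φ.Mem a → Ψ.Mem a)
    (P : Params → Prop) (X : ℕ) :
    (((Ψ.below X).filter P).card : ℝ) ≤
      ((Φ.below X).filter P).card + (((Ψ.below X).card : ℝ) - (Φ.below X).card) := by
  have hsubX := below_subset_below_of_subfamily hsub X
  -- split `{Ψ | P}` along `Φ(<X)`
  have h1 : ((Ψ.below X).filter P).card ≤
      ((Φ.below X).filter P).card + ((Ψ.below X) \ (Φ.below X)).card := by
    calc ((Ψ.below X).filter P).card
        ≤ (((Ψ.below X).filter P ∩ Φ.below X) ∪ ((Ψ.below X) \ (Φ.below X))).card := by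
          refine Finset.card_le_card fun a ha ↦ ?_
          rw [Finset.mem_union, Finset.mem_inter, Finset.mem_sdiff]
          by_cases h : a ∈ Φ.below X
          · exact Or.inl ⟨ha, h⟩
          · exact Or.inr ⟨(Finset.mem_filter.1 ha).1, h⟩
      _ ≤ ((Ψ.below X).filter P ∩ Φ.below X).card + ((Ψ.below X) \ (Φ.below X)).card :=
          Finset.card_union_le _ _
      _ ≤ ((Φ.below X).filter P).card + ((Ψ.below X) \ (Φ.below X)).card := by
          gcongr
          intro a ha
          rw [Finset.mem_inter, Finset.mem_filter] at ha
          exact Finset.mem_filter.2 ⟨ha.2, ha.1.2⟩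
  have h2 : ((Ψ.below X) \ (Φ.below X)).card = (Ψ.below X).card - (Φ.below X).card :=
    Finset.card_sdiff_of_subset hsubX
  have h3 : (Φ.below X).card ≤ (Ψ.below X).card := Finset.card_le_card hsubX
  have h1' : (((Ψ.below X).filter P).card : ℝ) ≤
      ((Φ.below X).filter P).card + (((Ψ.below X) \ (Φ.below X)).card : ℝ) := by exact_mod_cast h1
  rw [h2, Nat.cast_sub h3] at h1'
  exact h1'

/-- **One sieve step for lower densities.** `Φ ⊆ Ψ`, `Ψ.DensityOnGE P ρ` and eventually
`#Ψ(<X) ≤ (1 + δ)·#Φ(<X)` give, for every `ε > 0`, eventually `prop_Φ(P) ≥ ρ − ε − δ`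
(`ρ ≤ 1 + ε` is automatic from a proportion; the bound is used with `ρ − ε ≥ 0` or trivially).
[cite: BhargavaShankarAnnals2015, §2.7 (proof of Thm 2.21, lower bound)] -/
theorem proportionOn_ge_of_subfamily {Φ Ψ : CongruenceFamily₂} (hsub : ∀ a, Φ.Mem a → Ψ.Mem a)
    {P : Params → Prop} {ρ δ : ℝ} (hδ : 0 ≤ δ) (hΨ : Ψ.DensityOnGE P ρ)
    (hcount : ∀ᶠ X : ℕ in atTop, ((Ψ.below X).card : ℝ) ≤ (1 + δ) * (Φ.below X).card)
    {ε : ℝ} (hε : 0 < ε) :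
    ∀ᶠ X : ℕ in atTop, ρ - ε - δ ≤ Φ.proportionOn P X := by
  filter_upwards [hΨ ε hε, hcount] with X hX hcX
  rw [proportionOn_eq_card_filter_div] at hX ⊢
  have hsplit := card_filter_le_of_subfamily hsub P X
  have hΦle : ((Φ.below X).card : ℝ) ≤ (Ψ.below X).card := by
    exact_mod_cast Finset.card_le_card (below_subset_below_of_subfamily hsub X)
  rcases Nat.eq_zero_or_pos (Φ.below X).card with h0 | hpos
  · -- empty `Φ`-ball: then the `Ψ`-ball is empty too and `ρ ≤ ε`
    have hΦ0 : ((Φ.below X).card : ℝ) = 0 := by rw [h0, Nat.cast_zero]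
    have hΨ0 : ((Ψ.below X).card : ℝ) = 0 :=
      le_antisymm (by simpa [hΦ0] using hcX) (Nat.cast_nonneg _)
    rw [hΨ0, div_zero] at hX
    rw [hΦ0, div_zero]
    linarith
  · have hc : (0 : ℝ) < (Φ.below X).card := by exact_mod_cast hpos
    rw [le_div_iff₀ hc]
    -- `#{Ψ|P} ≥ (ρ - ε) #Ψ` (trivial if the `Ψ`-ball is empty)
    have hΨP : (ρ - ε) * (Ψ.below X).card ≤ ((Ψ.below X).filter P).card := by
      rcases Nat.eq_zero_or_pos (Ψ.below X).card with hΨ0 | hΨpos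
      · have : ((Ψ.below X).filter P).card = 0 :=
          Nat.eq_zero_of_le_zero (hΨ0 ▸ Finset.card_filter_le _ _)
        simp [hΨ0, this]
      · rwa [le_div_iff₀ (by exact_mod_cast hΨpos)] at hX
    -- combine
    by_cases hρε : 0 ≤ ρ - ε
    · have step : (ρ - ε) * (Φ.below X).card ≤ (ρ - ε) * (Ψ.below X).card :=
        mul_le_mul_of_nonneg_left hΦle hρε
      nlinarith [hsplit, hΨP, step, hcX, hc]
    · rw [not_le] at hρε
      have : (ρ - ε - δ) * (Φ.below X).card ≤ 0 :=
        mul_nonpos_of_nonpos_of_nonneg (by linarith) hc.le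
      have hnn : (0 : ℝ) ≤ ((Φ.below X).filter P).card := Nat.cast_nonneg _
      linarith

/-- **The sieve limit `δ → 0` for lower densities.** If for every `δ > 0` there is a super-family
`Ψ ⊇ Φ` with `Ψ.DensityOnGE P ρ` and eventually `#Ψ(<X) ≤ (1 + δ)·#Φ(<X)`, then `Φ.DensityOnGE P ρ`.
[cite: BhargavaShankarAnnals2015, §2.7 (proof of Thm 2.21)] -/
theorem densityOnGE_of_forall_subfamily {Φ : CongruenceFamily₂} {P : Params → Prop} {ρ : ℝ}
    (H : ∀ δ : ℝ, 0 < δ → ∃ Ψ : CongruenceFamily₂, (∀ a, Φ.Mem a → Ψ.Mem a) ∧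
      Ψ.DensityOnGE P ρ ∧
        ∀ᶠ X : ℕ in atTop, ((Ψ.below X).card : ℝ) ≤ (1 + δ) * (Φ.below X).card) :
    Φ.DensityOnGE P ρ := by
  intro ε hε
  obtain ⟨Ψ, hsub, hΨ, hcount⟩ := H (ε / 2) (half_pos hε)
  exact (proportionOn_ge_of_subfamily hsub (half_pos hε).le hΨ hcount (half_pos hε)).mono
    fun X hX ↦ by linarith

/-! ### §2 The sieve reduction for a large family (lower densities) -/

/-- **The large-family sieve reduction for lower densities.** Let `Φ ⊆ F₂` be LARGE with positive
lower relative density in `F₂`. If for all large `Y` the truncation `Φ_{<Y}` (the conditions of `Φ`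
at the primes `p < Y` only) satisfies `Φ_{<Y}.DensityOnGE P ρ`, and the tail estimate holds (for every
`η > 0` some `Y` with eventually `#{a ∈ F₂(<X) : ∃ p ≥ Y prime, p² ∣ Δ(a)} ≤ η·#F₂(<X)`), then
`Φ.DensityOnGE P ρ`. [cite: BhargavaHo2022, §9.1 Thm. 9.1 and Prop. 9.2; BhargavaShankarAnnals2015, §2.7] -/
theorem densityOnGE_of_isLarge_of_truncations {Φ : CongruenceFamily₂} (hΦ : Φ.IsLarge)
    {P : Params → Prop} {ρ : ℝ}
    (hrel : ∃ κ : ℝ, 0 < κ ∧ ∀ᶠ X : ℕ in atTop,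
      κ * ((CongruenceFamily₂.all.below X).card : ℝ) ≤ (Φ.below X).card)
    (htrunc : ∀ᶠ Y : ℕ in atTop,
      (⟨Φ.expt, fun p ↦ if p < Y then Φ.residues p else Set.univ⟩ : CongruenceFamily₂).DensityOnGE P ρ)
    (htail : ∀ η : ℝ, 0 < η → ∃ Y : ℕ, ∀ᶠ X : ℕ in atTop,
      (((CongruenceFamily₂.all.below X).filter fun a ↦
          ∃ p : ℕ, Y ≤ p ∧ p.Prime ∧ (p : ℤ) ^ 2 ∣ a.curveInt.Δ).card : ℝ) ≤
        η * (CongruenceFamily₂.all.below X).card) :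
    Φ.DensityOnGE P ρ := by
  obtain ⟨κ, hκ, hrelκ⟩ := hrel
  obtain ⟨p₀, hp₀⟩ := hΦ
  obtain ⟨N, hN⟩ := Filter.eventually_atTop.1 htrunc
  refine densityOnGE_of_forall_subfamily fun δ hδ ↦ ?_
  obtain ⟨Y, hY⟩ := htail (δ * κ) (mul_pos hδ hκ)
  set Y' : ℕ := max (max Y p₀) N with hY'
  have hYY' : Y ≤ Y' := (le_max_left _ _).trans (le_max_left _ _)
  have hp₀Y' : p₀ ≤ Y' := (le_max_right _ _).trans (le_max_left _ _)
  set Ψ : CongruenceFamily₂ := ⟨Φ.expt, fun p ↦ if p < Y' then Φ.residues p else Set.univ⟩ with hΨ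
  have hsub : ∀ a, Φ.Mem a → Ψ.Mem a := fun a ha ↦ by
    refine ⟨ha.1, fun p hp ↦ ?_⟩
    show Φ.residueOf p a ∈ (if p < Y' then Φ.residues p else Set.univ)
    split_ifs
    · exact ha.2 p hp
    · exact Set.mem_univ _
  have hT : ∀ a, Ψ.Mem a → ¬ Φ.Mem a →
      ∃ p : ℕ, Y ≤ p ∧ p.Prime ∧ (p : ℤ) ^ 2 ∣ a.curveInt.Δ := fun a haΨ haΦ ↦ by
    have hmem : a.IsMember := haΨ.1
    simp only [CongruenceFamily₂.Mem, not_and, not_forall] at haΦ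
    obtain ⟨p, hp, hpa⟩ := haΦ hmem
    have hres : Φ.residueOf p a ∈ (if p < Y' then Φ.residues p else Set.univ) := haΨ.2 p hp
    have hpY' : Y' ≤ p := by
      by_contra hlt
      rw [not_le] at hlt
      rw [if_pos hlt] at hres
      exact hpa hres
    refine ⟨p, hYY'.trans hpY', hp, ?_⟩
    by_contra hndvd
    exact hpa (hp₀ p (hp₀Y'.trans hpY') hp a hmem hndvd)
  refine ⟨Ψ, hsub, hN Y' (le_max_right _ _), ?_⟩
  have h := card_below_le_of_tail (Φ := Φ) (Ψ := Ψ) hT (mul_pos hδ hκ).le hκ hY hrelκ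
  have hδκ : δ * κ / κ = δ := by field_simp
  rw [hδκ] at h
  exact h

/-! ### §3 The instances for crux I2 (`P = (w = +1)`) -/

/-- **I2 on one large family from its truncations.** [cite: BhargavaHo2022, §9.1 (shape of the passage to large families)] -/
theorem rootNumberPlusLowerDensity_of_truncations (Φ : CongruenceFamily₂) (hΦ : Φ.IsLarge) {ρ : ℝ}
    (hrel : ∃ κ : ℝ, 0 < κ ∧ ∀ᶠ X : ℕ in atTop,
      κ * ((CongruenceFamily₂.all.below X).card : ℝ) ≤ (Φ.below X).card)
    (htrunc : ∀ᶠ Y : ℕ in atTop,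
      (⟨Φ.expt, fun p ↦ if p < Y then Φ.residues p else Set.univ⟩ : CongruenceFamily₂).DensityOnGE
        (fun a ↦ a.curve.rootNumber = 1) ρ)
    (htail : ∀ η : ℝ, 0 < η → ∃ Y : ℕ, ∀ᶠ X : ℕ in atTop,
      (((CongruenceFamily₂.all.below X).filter fun a ↦
          ∃ p : ℕ, Y ≤ p ∧ p.Prime ∧ (p : ℤ) ^ 2 ∣ a.curveInt.Δ).card : ℝ) ≤
        η * (CongruenceFamily₂.all.below X).card) :
    Φ.DensityOnGE (fun a ↦ a.curve.rootNumber = 1) ρ :=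
  densityOnGE_of_isLarge_of_truncations hΦ hrel htrunc htail

/-- I2 implies its finitely-conditioned case (such families are large): the reduction loses nothing.
[cite: BhargavaHo2022, §1 (definition of "large")] -/
theorem rootNumberPlusLowerDensity_finiteConditions_of_largeF2 (h : RootNumberPlusLowerDensityLargeF2)
    (Ψ : CongruenceFamily₂) (hY : ∃ Y : ℕ, ∀ p : ℕ, Y ≤ p → Ψ.residues p = Set.univ)
    (hne : ∀ p : ℕ, p.Prime → (Ψ.residues p).Nonempty) :
    ∃ ρ : ℝ, 1 / 6 < ρ ∧ Ψ.DensityOnGE (fun a ↦ a.curve.rootNumber = 1) ρ := by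
  obtain ⟨Y, hY⟩ := hY
  exact h Ψ (isLarge_of_residues_eq_univ Ψ hY) hne

/-- **The route decl I2 from a uniform lower density on finitely-conditioned families + the tail
estimate + Bhargava–Ho Thm. 9.1** (BY NAME). If (i) some `ρ₀ > 1/6` is a lower density of
`{w = +1}` in EVERY subfamily of `F₂` with finitely many congruence conditions and nonempty local
conditions (root-number equidistribution in height boxes with finitely many congruence conditions
would give `ρ₀ = 1/2`), (ii) the `p² ∣ Δ` tail estimate holds, and (iii) `thm9_1_F2`, then
`RootNumberPlusLowerDensityLargeF2`. [cite: BhargavaHo2022, Thm. 9.1, Prop. 9.2 (§9.1); BhargavaShankarTernary2015, §1 (root numbers in large families)] -/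
theorem rootNumberPlusLowerDensityLargeF2_of_finiteConditions (h9 : thm9_1_F2)
    (htail : ∀ η : ℝ, 0 < η → ∃ Y : ℕ, ∀ᶠ X : ℕ in atTop,
      (((CongruenceFamily₂.all.below X).filter fun a ↦
          ∃ p : ℕ, Y ≤ p ∧ p.Prime ∧ (p : ℤ) ^ 2 ∣ a.curveInt.Δ).card : ℝ) ≤
        η * (CongruenceFamily₂.all.below X).card)
    (hfin : ∃ ρ₀ : ℝ, 1 / 6 < ρ₀ ∧ ∀ Ψ : CongruenceFamily₂,
      (∃ Y : ℕ, ∀ p : ℕ, Y ≤ p → Ψ.residues p = Set.univ) →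
      (∀ p : ℕ, p.Prime → (Ψ.residues p).Nonempty) →
      Ψ.DensityOnGE (fun a ↦ a.curve.rootNumber = 1) ρ₀) :
    RootNumberPlusLowerDensityLargeF2 := by
  intro Φ hΦ hne
  obtain ⟨ρ₀, hρ₀, hfin⟩ := hfin
  refine ⟨ρ₀, hρ₀, rootNumberPlusLowerDensity_of_truncations Φ hΦ (thm9_1_F2.relative h9 Φ hΦ hne)
    (Filter.Eventually.of_forall fun Y ↦ hfin _ ⟨Y, fun p hp ↦ ?_⟩ fun p hp ↦ ?_) htail⟩
  · show (if p < Y then Φ.residues p else Set.univ) = Set.univ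
    rw [if_neg (not_lt.2 hp)]
  · show (if p < Y then Φ.residues p else Set.univ).Nonempty
    split_ifs
    · exact hne p hp
    · exact Set.univ_nonempty

end Summit.BirchSwinnertonDyer.BirchSwinnertonDyer.Theorems

end
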